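import Summits.MatrixMultiplication.OmegaCensus.STPPRankProjection
import Literature.Computability.AlgebraicComplexity.GroupTheoreticMatMulProofs
import Literature.Computability.AlgebraicComplexity.KroneckerRank

/-!
# ω-census (abelian STPP census, seat stpp-2), filter N7 part 2: flattening ranks peel off the rank of `⊕ᵢ ⟨kᵢ,mᵢ,nᵢ⟩`

HONEST FRAMING (pub-omega census; verbatim): lottery ticket; floor = certified bounds/negative ranges.
Census BOOKKEEPING (pub-omega stpp-2 gen 16, 2026-08-26): the tensor-rank lower bounds behind the census filter N7
(`STPPThinFamilies.lean`), in the kernel.  Nothing here is progress on `ω`.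

Iterating the projection lemma `STPPRank.peel` (`STPPRankProjection.lean`; Buczyński–Postinghel–Rupniewski 2020,
§3.1) over the blocks of a direct sum of matrix multiplication tensors (`matMulDirectSum`, `SchoenhageTau.lean`),
each block removed in a direction of one's choice (`R` is invariant under rotating the three factors,
`tensorRank_rotate`):

* `STPPRank.sub K k m n s` — `⊕_{i ∈ s} ⟨kᵢ,mᵢ,nᵢ⟩` as the sub-tensor of `matMulDirectSum K k m n` on the blocks in `s`;
* `STPPRank.gain d k m n` — the number of slices of `⟨k,m,n⟩` in direction `d` (`kn`, `km`, `mn`: a flattening rank);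
* `STPPRank.peel_sub` — removing block `i ∈ s` costs at least `gain(d; kᵢ,mᵢ,nᵢ)`, for any direction `d`;
* `STPPRank.sum_gain_le_tensorRank` — `∑ᵢ gain(dᵢ; kᵢ,mᵢ,nᵢ) ≤ R(⊕ᵢ ⟨kᵢ,mᵢ,nᵢ⟩)` for every choice of directions;
* `STPPRank.tensorRank_add_sum_gain_le_tensorRank` — `R(⟨k_{j₀},m_{j₀},n_{j₀}⟩) + ∑_{i ≠ j₀} gain(dᵢ;…) ≤ R(⊕ᵢ ⟨kᵢ,mᵢ,nᵢ⟩)`.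
All formats are assumed positive (`0 < kᵢ, mᵢ, nᵢ`).
-/

noncomputable section

open scoped BigOperators

namespace Summit.MatrixMultiplication.OmegaCensus.STPPRank

open Literature.Computability.AlgebraicComplexity Module Finset

/-! ## Direct sums of matrix multiplication tensors: peeling one block in a chosen direction -/

section DirectSum

variable (K : Type*) [Field K] {N : ℕ} (k m n : Fin N → ℕ)

/-- Membership of a first index (a form `Z^{(j)}_{κν}` of the sub-sum on `s`) in block `i`. [cite: Blaser2013, §7] -/
abbrev pA (k n : Fin N → ℕ) (s : Finset (Fin N)) (i : Fin N) :
    {a : (Σ i, Fin (k i) × Fin (n i)) // a.1 ∈ s} → Prop := fun a => a.1.1 = i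

/-- Membership of a second index (a variable `X^{(j)}_{κμ}`) in block `i`. [cite: Blaser2013, §7] -/
abbrev pB (k m : Fin N → ℕ) (s : Finset (Fin N)) (i : Fin N) :
    {b : (Σ i, Fin (k i) × Fin (m i)) // b.1 ∈ s} → Prop := fun b => b.1.1 = i

/-- Membership of a third index (a variable `Y^{(j)}_{μν}`) in block `i`. [cite: Blaser2013, §7] -/
abbrev pC (m n : Fin N → ℕ) (s : Finset (Fin N)) (i : Fin N) :
    {c : (Σ i, Fin (m i) × Fin (n i)) // c.1 ∈ s} → Prop := fun c => c.1.1 = i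

/-- `⊕_{i ∈ s} ⟨kᵢ, mᵢ, nᵢ⟩`: the sub-tensor of `matMulDirectSum K k m n` (`SchoenhageTau.lean`) on the blocks `i ∈ s`.
[cite: Blaser2013, §7] -/
def sub (s : Finset (Fin N)) :
    {a : (Σ i, Fin (k i) × Fin (n i)) // a.1 ∈ s} → {b : (Σ i, Fin (k i) × Fin (m i)) // b.1 ∈ s} →
      {c : (Σ i, Fin (m i) × Fin (n i)) // c.1 ∈ s} → K :=
  fun a b c => matMulDirectSum K k m n a b c

/-- The number of slices of the block `⟨k, m, n⟩` in direction `d`: `d = 0` — first index (the `k·n` forms `Z_{κν}`),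
`d = 1` — second index (the `k·m` variables `X_{κμ}`), `d = 2` — third index (the `m·n` variables `Y_{μν}`); each
is a flattening rank of `⟨k, m, n⟩`. [cite: BuczynskiPostinghelRupniewski2020, §3.1] -/
def gain (d : Fin 3) (k m n : ℕ) : ℕ := if d = 0 then k * n else if d = 1 then k * m else m * n

/-- The whole direct sum dominates every sub-sum (restriction to the blocks in `s`). [cite: Blaser2013, Lemma 5.4] -/
theorem tensorRank_sub_le (s : Finset (Fin N)) :
    tensorRank (sub K k m n s) ≤ tensorRank (matMulDirectSum K k m n) :=
  tensorRank_precomp_le (matMulDirectSum K k m n) Subtype.val Subtype.val Subtype.val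

/-- A single block of the sub-sum is the matrix multiplication tensor of that block. [cite: Blaser2013, §7] -/
theorem tensorRank_matMulTensor_le_sub {s : Finset (Fin N)} {j : Fin N} (hj : j ∈ s) :
    tensorRank (matMulTensor K (k j) (m j) (n j)) ≤ tensorRank (sub K k m n s) := by
  have h := tensorRank_precomp_le (sub K k m n s)
    (fun x : Fin (k j) × Fin (n j) => (⟨⟨j, x⟩, hj⟩ : {a : (Σ i, Fin (k i) × Fin (n i)) // a.1 ∈ s}))
    (fun x : Fin (k j) × Fin (m j) => (⟨⟨j, x⟩, hj⟩ : {b : (Σ i, Fin (k i) × Fin (m i)) // b.1 ∈ s}))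
    (fun x : Fin (m j) × Fin (n j) => (⟨⟨j, x⟩, hj⟩ : {c : (Σ i, Fin (m i) × Fin (n i)) // c.1 ∈ s}))
  have e : (fun a b c => sub K k m n s ⟨⟨j, a⟩, hj⟩ ⟨⟨j, b⟩, hj⟩ ⟨⟨j, c⟩, hj⟩) =
      matMulTensor K (k j) (m j) (n j) := by
    funext a b c
    exact matMulDirectSum_block K k m n j a b c
  rw [e] at h
  exact h

variable {K k m n}

/-- Block-diagonal shape of a sub-sum with respect to one block `i`. [cite: Blaser2013, §7] -/
theorem blockVanishing_sub (s : Finset (Fin N)) (i : Fin N) :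
    BlockVanishing (pA k n s i) (pB k m s i) (pC m n s i) (sub K k m n s) := by
  intro a b c h
  have hne : a.1.1 ≠ b.1.1 ∨ b.1.1 ≠ c.1.1 := by
    by_contra hc
    rw [not_or, not_not, not_not] at hc
    exact h ⟨by show a.1.1 = i ↔ b.1.1 = i; rw [hc.1], by show b.1.1 = i ↔ c.1.1 = i; rw [hc.2]⟩
  exact matMulDirectSum_of_ne K k m n hne

/-- Removing block `i` from the index set: the sub-sum on `s.erase i` embeds into the lower block.
[cite: Blaser2013, Lemma 5.4] -/
theorem tensorRank_sub_erase_le_lowerBlock (s : Finset (Fin N)) (i : Fin N) :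
    tensorRank (sub K k m n (s.erase i)) ≤
      tensorRank (lowerBlock (pA k n s i) (pB k m s i) (pC m n s i) (sub K k m n s)) :=
  tensorRank_precomp_le (lowerBlock (pA k n s i) (pB k m s i) (pC m n s i) (sub K k m n s))
    (fun x : {a : (Σ i, Fin (k i) × Fin (n i)) // a.1 ∈ s.erase i} =>
      (⟨⟨x.1, Finset.mem_of_mem_erase x.2⟩, Finset.ne_of_mem_erase x.2⟩ :
        {a : {a : (Σ i, Fin (k i) × Fin (n i)) // a.1 ∈ s} // ¬ a.1.1 = i}))
    (fun x : {b : (Σ i, Fin (k i) × Fin (m i)) // b.1 ∈ s.erase i} =>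
      (⟨⟨x.1, Finset.mem_of_mem_erase x.2⟩, Finset.ne_of_mem_erase x.2⟩ :
        {b : {b : (Σ i, Fin (k i) × Fin (m i)) // b.1 ∈ s} // ¬ b.1.1 = i}))
    (fun x : {c : (Σ i, Fin (m i) × Fin (n i)) // c.1 ∈ s.erase i} =>
      (⟨⟨x.1, Finset.mem_of_mem_erase x.2⟩, Finset.ne_of_mem_erase x.2⟩ :
        {c : {c : (Σ i, Fin (m i) × Fin (n i)) // c.1 ∈ s} // ¬ c.1.1 = i}))

/-- The first-index slices of one block `⟨kᵢ, mᵢ, nᵢ⟩` (`mᵢ ≥ 1`) are linearly independent: slice `(κ, ν)` alone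
is non-zero at `X_{κ 0}, Y_{0 ν}`. [folklore] -/
theorem linearIndependent_upperSlice_dir0 (s : Finset (Fin N)) (i : Fin N) (hm : 0 < m i) :
    LinearIndependent K (upperSlice (pA k n s i) (pB k m s i) (pC m n s i) (sub K k m n s)) := by
  classical
  refine linearIndependent_of_delta _
    (fun a' => ⟨⟨⟨a'.1.1.1, (a'.1.1.2.1, ⟨0, by rw [a'.2]; exact hm⟩)⟩, a'.1.2⟩, a'.2⟩)
    (fun a' => ⟨⟨⟨a'.1.1.1, (⟨0, by rw [a'.2]; exact hm⟩, a'.1.1.2.2)⟩, a'.1.2⟩, a'.2⟩) ?_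
  rintro ⟨⟨⟨j, x, z⟩, hjs⟩, hj⟩ ⟨⟨⟨j', x', z'⟩, hjs'⟩, hj'⟩
  dsimp only [pA, pB, pC] at hj hj'
  subst hj hj'
  simp [upperSlice, sub, matMulDirectSum, Fin.ext_iff]

/-- Second-index slices of one block (`nᵢ ≥ 1`) are linearly independent: slice `(κ, μ)` alone is non-zero at
`Z_{κ 0}, Y_{μ 0}`. [folklore] -/
theorem linearIndependent_upperSlice_dir1 (s : Finset (Fin N)) (i : Fin N) (hn : 0 < n i) :
    LinearIndependent K (upperSlice (pB k m s i) (pC m n s i) (pA k n s i)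
      (rotate (sub K k m n s))) := by
  classical
  refine linearIndependent_of_delta _
    (fun b' => ⟨⟨⟨b'.1.1.1, (b'.1.1.2.2, ⟨0, by rw [b'.2]; exact hn⟩)⟩, b'.1.2⟩, b'.2⟩)
    (fun b' => ⟨⟨⟨b'.1.1.1, (b'.1.1.2.1, ⟨0, by rw [b'.2]; exact hn⟩)⟩, b'.1.2⟩, b'.2⟩) ?_
  rintro ⟨⟨⟨j, x, y⟩, hjs⟩, hj⟩ ⟨⟨⟨j', x', y'⟩, hjs'⟩, hj'⟩
  dsimp only [pA, pB, pC] at hj hj'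
  subst hj hj'
  simp [upperSlice, sub, rotate, matMulDirectSum, Fin.ext_iff]
  split_ifs with h1 h2 h2
  · rfl
  · exact absurd ⟨h1.1.symm, h1.2⟩ h2
  · exact absurd ⟨h2.1.symm, h2.2⟩ h1
  · rfl

/-- Third-index slices of one block (`kᵢ ≥ 1`) are linearly independent: slice `(μ, ν)` alone is non-zero at
`Z_{0 ν}, X_{0 μ}`. [folklore] -/
theorem linearIndependent_upperSlice_dir2 (s : Finset (Fin N)) (i : Fin N) (hk : 0 < k i) :
    LinearIndependent K (upperSlice (pC m n s i) (pA k n s i) (pB k m s i)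
      (rotate (rotate (sub K k m n s)))) := by
  classical
  refine linearIndependent_of_delta _
    (fun c' => ⟨⟨⟨c'.1.1.1, (⟨0, by rw [c'.2]; exact hk⟩, c'.1.1.2.2)⟩, c'.1.2⟩, c'.2⟩)
    (fun c' => ⟨⟨⟨c'.1.1.1, (⟨0, by rw [c'.2]; exact hk⟩, c'.1.1.2.1)⟩, c'.1.2⟩, c'.2⟩) ?_
  rintro ⟨⟨⟨j, y, z⟩, hjs⟩, hj⟩ ⟨⟨⟨j', y', z'⟩, hjs'⟩, hj'⟩
  dsimp only [pA, pB, pC] at hj hj'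
  subst hj hj'
  simp only [upperSlice, sub, rotate, matMulDirectSum,
    show ((y' : ℕ) = y ∧ (z' : ℕ) = z ↔ (y : ℕ) = y' ∧ (z : ℕ) = z') from
      ⟨fun h => ⟨h.1.symm, h.2.symm⟩, fun h => ⟨h.1.symm, h.2.symm⟩⟩]
  simp [Fin.ext_iff]

/-- The block `i` has at least `kᵢ nᵢ` first indices, `kᵢ mᵢ` second indices, `mᵢ nᵢ` third indices inside the
sub-sum on `s ∋ i`. [folklore] -/
theorem card_block_ge (s : Finset (Fin N)) {i : Fin N} (hi : i ∈ s) (f g : Fin N → ℕ) :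
    f i * g i ≤ Fintype.card {a : {a : (Σ j, Fin (f j) × Fin (g j)) // a.1 ∈ s} // a.1.1 = i} := by
  classical
  have h := Fintype.card_le_of_injective
    (fun x : Fin (f i) × Fin (g i) => (⟨⟨⟨i, x⟩, hi⟩, rfl⟩ : {a : {a : (Σ j, Fin (f j) × Fin (g j)) // a.1 ∈ s} // a.1.1 = i}))
    (by
      intro x y hxy
      simp only [Subtype.mk.injEq] at hxy
      exact eq_of_heq (Sigma.mk.inj_iff.mp hxy).2)
  simpa [Fintype.card_prod, Fintype.card_fin] using h

/-- **Peeling one block, any direction.** For `i ∈ s` with `kᵢ, mᵢ, nᵢ ≥ 1` and a direction `d`,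
`R(⊕_{s ∖ i}) + gain(d; kᵢ, mᵢ, nᵢ) ≤ R(⊕_s)` (the projection lemma `peel` applied to the suitably rotated sub-sum;
`R` is invariant under rotation, `tensorRank_rotate`). [cite: BuczynskiPostinghelRupniewski2020, §3.1 (first Lemma)] -/
theorem peel_sub (s : Finset (Fin N)) {i : Fin N} (hi : i ∈ s) (hk : 0 < k i) (hm : 0 < m i) (hn : 0 < n i)
    (d : Fin 3) : tensorRank (sub K k m n (s.erase i)) + gain d (k i) (m i) (n i) ≤ tensorRank (sub K k m n s) := by
  classical
  have h1 := tensorRank_sub_erase_le_lowerBlock (K := K) (k := k) (m := m) (n := n) s i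
  fin_cases d
  · -- first index
    have hpeel := peel _ _ _ (blockVanishing_sub (K := K) (k := k) (m := m) (n := n) s i)
    have h2 := card_block_ge s hi k n
    rw [← finrank_span_eq_card (linearIndependent_upperSlice_dir0 (K := K) (k := k) (m := m) (n := n) s i hm)] at h2
    simp [gain]
    omega
  · -- second index: rotate once
    have hvan : BlockVanishing (pB k m s i) (pC m n s i) (pA k n s i) (rotate (sub K k m n s)) :=
      fun b c a h => blockVanishing_sub (K := K) (k := k) (m := m) (n := n) s i a b c (by tauto)
    have hpeel := peel _ _ _ hvan
    rw [tensorRank_rotate] at hpeel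
    have hrot : tensorRank (lowerBlock (pB k m s i) (pC m n s i) (pA k n s i) (rotate (sub K k m n s))) =
        tensorRank (lowerBlock (pA k n s i) (pB k m s i) (pC m n s i) (sub K k m n s)) :=
      tensorRank_rotate _
    rw [hrot] at hpeel
    have h2 := card_block_ge s hi k m
    rw [← finrank_span_eq_card (linearIndependent_upperSlice_dir1 (K := K) (k := k) (m := m) (n := n) s i hn)] at h2
    simp [gain]
    omega
  · -- third index: rotate twice
    have hvan : BlockVanishing (pC m n s i) (pA k n s i) (pB k m s i) (rotate (rotate (sub K k m n s))) :=
      fun c a b h => blockVanishing_sub (K := K) (k := k) (m := m) (n := n) s i a b c (by tauto)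
    have hpeel := peel _ _ _ hvan
    rw [tensorRank_rotate, tensorRank_rotate] at hpeel
    have hrot : tensorRank (lowerBlock (pC m n s i) (pA k n s i) (pB k m s i) (rotate (rotate (sub K k m n s)))) =
        tensorRank (lowerBlock (pA k n s i) (pB k m s i) (pC m n s i) (sub K k m n s)) := by
      rw [← tensorRank_rotate (lowerBlock _ _ _ (sub K k m n s)), ← tensorRank_rotate (rotate _)]
      rfl
    rw [hrot] at hpeel
    have h2 := card_block_ge s hi m n
    rw [← finrank_span_eq_card (linearIndependent_upperSlice_dir2 (K := K) (k := k) (m := m) (n := n) s i hk)] at h2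
    simp [gain]
    omega

/-! ## §3 The rank of `⊕ᵢ ⟨kᵢ,mᵢ,nᵢ⟩` is at least the sum of chosen flattening ranks (plus one block's rank) -/

/-- **All blocks peeled**: `∑_{i ∈ s} gain(dᵢ; kᵢ,mᵢ,nᵢ) ≤ R(⊕_{i∈s} ⟨kᵢ,mᵢ,nᵢ⟩)` for every choice of directions
`d`, all formats positive. [cite: BuczynskiPostinghelRupniewski2020, §3.1 (first Lemma, iterated)] -/
theorem sum_gain_le_tensorRank_sub (hpos : ∀ i, 0 < k i ∧ 0 < m i ∧ 0 < n i) (d : Fin N → Fin 3) (s : Finset (Fin N)) :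
    ∑ i ∈ s, gain (d i) (k i) (m i) (n i) ≤ tensorRank (sub K k m n s) := by
  classical
  induction s using Finset.induction_on with
  | empty => simp
  | @insert i s his ih =>
    rw [Finset.sum_insert his]
    have h := peel_sub (K := K) (k := k) (m := m) (n := n) (insert i s) (Finset.mem_insert_self i s)
      (hpos i).1 (hpos i).2.1 (hpos i).2.2 (d i)
    rw [Finset.erase_insert his] at h
    omega

/-- **All blocks but one peeled**: for `j₀ ∈ s`,
`R(⟨k_{j₀},m_{j₀},n_{j₀}⟩) + ∑_{i ∈ s ∖ j₀} gain(dᵢ; kᵢ,mᵢ,nᵢ) ≤ R(⊕_{i∈s} ⟨kᵢ,mᵢ,nᵢ⟩)`.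
[cite: BuczynskiPostinghelRupniewski2020, §3.1 (first Lemma, iterated)] -/
theorem tensorRank_add_sum_gain_le_tensorRank_sub (hpos : ∀ i, 0 < k i ∧ 0 < m i ∧ 0 < n i) (d : Fin N → Fin 3)
    (j₀ : Fin N) (s : Finset (Fin N)) (hj : j₀ ∉ s) :
    tensorRank (matMulTensor K (k j₀) (m j₀) (n j₀)) + ∑ i ∈ s, gain (d i) (k i) (m i) (n i) ≤
      tensorRank (sub K k m n (insert j₀ s)) := by
  classical
  induction s using Finset.induction_on with
  | empty =>
    simpa using tensorRank_matMulTensor_le_sub K k m n (Finset.mem_insert_self j₀ ∅)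
  | @insert i s his ih =>
    have hij : j₀ ≠ i := fun h => hj (h ▸ Finset.mem_insert_self i s)
    have hj' : j₀ ∉ s := fun h => hj (Finset.mem_insert_of_mem h)
    rw [Finset.sum_insert his]
    have h := peel_sub (K := K) (k := k) (m := m) (n := n) (insert j₀ (insert i s))
      (Finset.mem_insert_of_mem (Finset.mem_insert_self i s)) (hpos i).1 (hpos i).2.1 (hpos i).2.2 (d i)
    have he : (insert j₀ (insert i s)).erase i = insert j₀ s := by
      rw [Finset.erase_insert_of_ne hij, Finset.erase_insert his]
    rw [he] at h
    have := ih hj'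
    omega

/-- **Theorem (flattening peel for `⊕ᵢ ⟨kᵢ,mᵢ,nᵢ⟩`).** `∑ᵢ gain(dᵢ; kᵢ,mᵢ,nᵢ) ≤ R(⊕ᵢ ⟨kᵢ,mᵢ,nᵢ⟩)` for every choice of
directions (all formats positive). [cite: BuczynskiPostinghelRupniewski2020, §3.1 (first Lemma, iterated)] -/
theorem sum_gain_le_tensorRank (hpos : ∀ i, 0 < k i ∧ 0 < m i ∧ 0 < n i) (d : Fin N → Fin 3) :
    ∑ i, gain (d i) (k i) (m i) (n i) ≤ tensorRank (matMulDirectSum K k m n) :=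
  (sum_gain_le_tensorRank_sub (K := K) hpos d Finset.univ).trans (tensorRank_sub_le K k m n Finset.univ)

/-- **Theorem (one block's rank plus the flattening ranks of the others).**
`R(⟨k_{j₀},m_{j₀},n_{j₀}⟩) + ∑_{i ≠ j₀} gain(dᵢ; kᵢ,mᵢ,nᵢ) ≤ R(⊕ᵢ ⟨kᵢ,mᵢ,nᵢ⟩)`.
[cite: BuczynskiPostinghelRupniewski2020, §3.1 (first Lemma, iterated)] -/
theorem tensorRank_add_sum_gain_le_tensorRank (hpos : ∀ i, 0 < k i ∧ 0 < m i ∧ 0 < n i) (d : Fin N → Fin 3)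
    (j₀ : Fin N) :
    tensorRank (matMulTensor K (k j₀) (m j₀) (n j₀)) + ∑ i ∈ Finset.univ.erase j₀, gain (d i) (k i) (m i) (n i) ≤
      tensorRank (matMulDirectSum K k m n) := by
  classical
  have h := tensorRank_add_sum_gain_le_tensorRank_sub (K := K) hpos d j₀ (Finset.univ.erase j₀)
    (Finset.notMem_erase j₀ _)
  rw [Finset.insert_erase (Finset.mem_univ j₀)] at h
  exact h.trans (tensorRank_sub_le K k m n Finset.univ)

end DirectSum

end Summit.MatrixMultiplication.OmegaCensus.STPPRank

end
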